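import Literature.Analysis.FluidPDE.PassiveScalarProofs
import HarnessLib

/-!
# The DiPerna–Lions commutator for velocity fields with an `L²` translation modulus

Analysis/FluidPDE proof-support file (everything proved). The tree's `PassiveScalarProofs` treats
the commutator
`r_ε[δ](x) = ∫ δ(y) ⟪v(x) - v(y), ∇k_ε(x - y)⟫ dy` of a time slice for *Lipschitz* drifts `v`
(`Torus.abs_comm_le`, `Torus.eLpNorm_comm_le`, `Torus.tendsto_eLpNorm_comm`). Here we treat
drifts that are only controlled through an `L²` **translation modulus** at scale `ε`,

  `‖v(· + z) - v‖_{L²} ≤ A`  whenever  `∇k_ε(z) ≠ 0`  (so `‖reprc z‖ ≤ ε`),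

which for `v ∈ Ḣ¹(T^d)` holds with `A = ε ‖∇v‖_{L²}` (`TorusTranslationEstimate`), as needed for
the `L²ₜ(L² ∩ Ḣ¹)ₓ` drifts of Seis 2022, Thm. 2 (DiPerna–Lions 1989, Lemma II.1 with
`p = q = 2`):

* `Torus.lintegral_lintegral_weight_mul_sub_mul_gradient_kernel_le` — the Tonelli/Hölder core:
  `∫∫ a(y) ‖v x - v y‖ ‖∇k_ε(x-y)‖ dy dx ≤ ‖a‖_{L²} · A · C₁/ε`;
* `Torus.lintegral_enorm_comm_le_of_translate` — **the `L¹` commutator bound**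
  `‖r_ε[δ]‖_{L¹} ≤ (C₁/ε) A ‖δ‖_{L²}`;
* `Torus.integral_inner_sub_gradient_eq_zero_of_integrable` — `∫ ⟪v x - v y, ∇k(x-y)⟫ dy = 0`
  for a.e.… in fact every `x`, for integrable weakly divergence-free `v` and smooth `k`;
* `Torus.lintegral_enorm_comm_le_of_uniformContinuous` — for continuous `g` with oscillation
  `≤ w₀` at scale `ε`: `‖r_ε[g]‖_{L¹} ≤ (C₁/ε) A w₀`;
* `Torus.lintegral_enorm_comm_le_add` — combining by linearity,
  `‖r_ε[δ]‖_{L¹} ≤ (C₁/ε) A (‖δ - g‖_{L²} + w₀)`, the quantitative form from which the strong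
  convergence `r_ε → 0` follows once `A = O(ε)`.

## References

* R. J. DiPerna, P.-L. Lions, Invent. Math. 98 (1989), §II.1, Lemma II.1. [`DiPernaLions1989`]
* L. Ambrosio, G. Crippa, Proc. Roy. Soc. Edinburgh 144A (2014), §4, Thm. 4.6.
  [`AmbrosioCrippa2014`]
-/

noncomputable section

open MeasureTheory TopologicalSpace Set Function Filter Topology Metric ContinuousLinearMap
open scoped ENNReal NNReal Convolution ContDiff InnerProductSpace

namespace Literature.Analysis.FluidPDE

namespace Torus

variable {d : Type*} [Fintype d]

section Commutator

variable {δ g : UnitAddTorus d → ℝ} {v : UnitAddTorus d → EuclideanSpace ℝ d} {ε : ℝ} {A : ℝ≥0∞}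

/-- Where `∇k_ε(z) ≠ 0` the centred representative of `z` has norm `≤ ε` (`0 < ε ≤ 1/4`). [folklore] -/
theorem norm_reprc_le_of_gradient_kernel_ne_zero (hε : 0 < ε) (hε' : ε ≤ 1 / 4) {z : UnitAddTorus d}
    (hz : FunctionSpaces.Torus.gradient (FunctionSpaces.Torus.kernel ε) z ≠ 0) :
    ‖FunctionSpaces.Torus.reprc z‖ ≤ ε := by
  by_contra h
  apply hz
  rw [FunctionSpaces.Torus.gradient_kernel hε hε', _root_.gradient,
    FunctionSpaces.Torus.fderiv_profile_eq_zero hε (lt_of_not_ge h), map_zero]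

/-- **The Tonelli/Hölder core of the `L¹` commutator bound**, for a measurable drift `w`.
For a measurable weight `a : T^d → [0,∞]`, `k = kernel ε` and a translation modulus `A` at
scale `ε` (`‖w(· + z) - w‖_{L²} ≤ A` whenever `∇k_ε(z) ≠ 0`):
`∫∫ a(y) ‖w x - w y‖ ‖∇k_ε(x - y)‖ dy dx ≤ (∫ a²)^{1/2} · A · C₁/ε`
(`x = z + y`, Tonelli twice, Hölder in `y`, and `∫ ‖∇k_ε‖ = C₁/ε`). [folklore] -/
theorem lintegral_lintegral_weight_mul_sub_mul_gradient_kernel_le_of_measurable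
    {a : UnitAddTorus d → ℝ≥0∞} (ha : AEMeasurable a volume) {w : UnitAddTorus d → EuclideanSpace ℝ d}
    (hw : Measurable w) (hε : 0 < ε) (hε' : ε ≤ 1 / 4)
    (hA : ∀ z : UnitAddTorus d, FunctionSpaces.Torus.gradient (FunctionSpaces.Torus.kernel ε) z ≠ 0 →
      eLpNorm (fun y => w (y + z) - w y) 2 volume ≤ A) :
    ∫⁻ x, ∫⁻ y, a y * ‖w x - w y‖ₑ *
        ‖FunctionSpaces.Torus.gradient (FunctionSpaces.Torus.kernel ε) (x - y)‖ₑ ≤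
      (∫⁻ y, a y ^ (2 : ℝ)) ^ (1 / 2 : ℝ) * A * ENNReal.ofReal (ε⁻¹ * FunctionSpaces.Torus.gradProfileMass d) := by
  set K : UnitAddTorus d → EuclideanSpace ℝ d :=
    FunctionSpaces.Torus.gradient (FunctionSpaces.Torus.kernel ε) with hK
  have hKc : Continuous K := FunctionSpaces.Torus.continuous_gradient_kernel (d := d) hε hε'
  have hKm : Measurable fun z => ‖K z‖ₑ := hKc.measurable.enorm
  have hF : AEMeasurable (fun p : UnitAddTorus d × UnitAddTorus d =>
      a p.2 * ‖w p.1 - w p.2‖ₑ * ‖K (p.1 - p.2)‖ₑ) (volume.prod volume) :=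
    ((ha.comp_quasiMeasurePreserving Measure.quasiMeasurePreserving_snd).mul
      (((hw.comp measurable_fst).sub (hw.comp measurable_snd)).enorm).aemeasurable).mul
      (hKm.comp (measurable_fst.sub measurable_snd)).aemeasurable
  have hF2 : AEMeasurable (fun p : UnitAddTorus d × UnitAddTorus d =>
      a p.1 * ‖w (p.2 + p.1) - w p.1‖ₑ * ‖K p.2‖ₑ) (volume.prod volume) :=
    ((ha.comp_quasiMeasurePreserving Measure.quasiMeasurePreserving_fst).mul
      (((hw.comp (measurable_snd.add measurable_fst)).sub (hw.comp measurable_fst)).enorm).aemeasurable).mul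
      (hKm.comp measurable_snd).aemeasurable
  calc ∫⁻ x, ∫⁻ y, a y * ‖w x - w y‖ₑ * ‖K (x - y)‖ₑ
      = ∫⁻ y, ∫⁻ x, a y * ‖w x - w y‖ₑ * ‖K (x - y)‖ₑ := lintegral_lintegral_swap hF
    _ = ∫⁻ y, ∫⁻ z, a y * ‖w (z + y) - w y‖ₑ * ‖K z‖ₑ := by
        refine lintegral_congr fun y => ?_
        rw [← lintegral_add_right_eq_self (fun x => a y * ‖w x - w y‖ₑ * ‖K (x - y)‖ₑ) y]
        simp only [add_sub_cancel_right]
    _ = ∫⁻ z, ∫⁻ y, a y * ‖w (z + y) - w y‖ₑ * ‖K z‖ₑ := lintegral_lintegral_swap hF2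
    _ = ∫⁻ z, ‖K z‖ₑ * ∫⁻ y, a y * ‖w (z + y) - w y‖ₑ := by
        refine lintegral_congr fun z => ?_
        rw [← lintegral_const_mul' _ _ enorm_ne_top]
        exact lintegral_congr fun y => by ring
    _ ≤ ∫⁻ z, ‖K z‖ₑ * ((∫⁻ y, a y ^ (2 : ℝ)) ^ (1 / 2 : ℝ) * A) := by
        refine lintegral_mono fun z => ?_
        by_cases hz : K z = 0
        · simp [hz]
        · refine mul_le_mul' le_rfl ?_
          have hm2 : AEMeasurable (fun y => ‖w (z + y) - w y‖ₑ) volume :=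
            ((hw.comp (measurable_const_add z)).sub hw).enorm.aemeasurable
          have hH := ENNReal.lintegral_mul_le_Lp_mul_Lq (volume : Measure (UnitAddTorus d))
            Real.HolderConjugate.two_two ha hm2
          have e2 : (∫⁻ y, ‖w (z + y) - w y‖ₑ ^ (2 : ℝ)) ^ (1 / (2 : ℝ)) =
              eLpNorm (fun y => w (y + z) - w y) 2 volume := by
            rw [eLpNorm_eq_lintegral_rpow_enorm_toReal two_ne_zero ENNReal.ofNat_ne_top, ENNReal.toReal_ofNat]
            simp_rw [add_comm z]
          calc ∫⁻ y, a y * ‖w (z + y) - w y‖ₑ = ∫⁻ y, (a * fun y => ‖w (z + y) - w y‖ₑ) y := rfl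
            _ ≤ (∫⁻ y, a y ^ (2 : ℝ)) ^ (1 / (2 : ℝ)) * (∫⁻ y, ‖w (z + y) - w y‖ₑ ^ (2 : ℝ)) ^ (1 / (2 : ℝ)) := hH
            _ ≤ (∫⁻ y, a y ^ (2 : ℝ)) ^ (1 / 2 : ℝ) * A := by
                rw [e2]
                exact mul_le_mul' le_rfl (hA z hz)
    _ = (∫⁻ z, ‖K z‖ₑ) * ((∫⁻ y, a y ^ (2 : ℝ)) ^ (1 / 2 : ℝ) * A) := lintegral_mul_const _ hKm
    _ = (∫⁻ y, a y ^ (2 : ℝ)) ^ (1 / 2 : ℝ) * A * ENNReal.ofReal (ε⁻¹ * FunctionSpaces.Torus.gradProfileMass d) := by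
        rw [hK, FunctionSpaces.Torus.lintegral_enorm_gradient_kernel hε hε']
        ring

/-- **The Tonelli/Hölder core**, for an a.e.-strongly measurable drift `v` (reduce to a
measurable representative: all quantities are invariant under a.e. modification of `v`). [folklore] -/
theorem lintegral_lintegral_weight_mul_sub_mul_gradient_kernel_le {a : UnitAddTorus d → ℝ≥0∞}
    (ha : AEMeasurable a volume) (hv : AEStronglyMeasurable v volume) (hε : 0 < ε) (hε' : ε ≤ 1 / 4)
    (hA : ∀ z : UnitAddTorus d, FunctionSpaces.Torus.gradient (FunctionSpaces.Torus.kernel ε) z ≠ 0 →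
      eLpNorm (fun y => v (y + z) - v y) 2 volume ≤ A) :
    ∫⁻ x, ∫⁻ y, a y * ‖v x - v y‖ₑ *
        ‖FunctionSpaces.Torus.gradient (FunctionSpaces.Torus.kernel ε) (x - y)‖ₑ ≤
      (∫⁻ y, a y ^ (2 : ℝ)) ^ (1 / 2 : ℝ) * A * ENNReal.ofReal (ε⁻¹ * FunctionSpaces.Torus.gradProfileMass d) := by
  set K : UnitAddTorus d → EuclideanSpace ℝ d :=
    FunctionSpaces.Torus.gradient (FunctionSpaces.Torus.kernel ε) with hK
  set w : UnitAddTorus d → EuclideanSpace ℝ d := hv.mk v with hw_def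
  have hw : Measurable w := hv.stronglyMeasurable_mk.measurable
  have hvw : v =ᵐ[volume] w := hv.ae_eq_mk
  -- the double integral is unchanged
  have hae : ∀ᵐ x ∂(volume : Measure (UnitAddTorus d)),
      ∫⁻ y, a y * ‖v x - v y‖ₑ * ‖K (x - y)‖ₑ = ∫⁻ y, a y * ‖w x - w y‖ₑ * ‖K (x - y)‖ₑ := by
    filter_upwards [hvw] with x hx
    refine lintegral_congr_ae ?_
    filter_upwards [hvw] with y hy
    rw [hx, hy]
  rw [lintegral_congr_ae hae]
  -- the translation modulus is unchanged
  refine lintegral_lintegral_weight_mul_sub_mul_gradient_kernel_le_of_measurable ha hw hε hε'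
    fun z hz => ?_
  have h1 : (fun y => w (y + z) - w y) =ᵐ[volume] fun y => v (y + z) - v y := by
    have ht : (fun y => v (y + z)) =ᵐ[volume] fun y => w (y + z) :=
      (measurePreserving_add_right volume z).quasiMeasurePreserving.ae_eq_comp hvw
    filter_upwards [ht, hvw] with y hy hy'
    rw [← hy', show w (y + z) = v (y + z) from hy.symm]
  rw [eLpNorm_congr_ae h1]
  exact hA z hz

/-- Integrability of the commutator integrand `y ↦ δ y ⟪v x - v y, ∇k(x - y)⟫` for `δ ∈ L¹`,
`δ ‖v‖ ∈ L¹` and continuous `k`-gradient. [folklore] -/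
theorem integrable_commIntegrand_of_integrable (hδ : Integrable δ volume)
    (hv : AEStronglyMeasurable v volume) (hvδ : Integrable (fun y => ‖v y‖ * δ y) volume)
    {k : UnitAddTorus d → ℝ} (hk : FunctionSpaces.Torus.IsSmooth k) (x : UnitAddTorus d) :
    Integrable (fun y => δ y * ⟪v x - v y, FunctionSpaces.Torus.gradient k (x - y)⟫_ℝ) volume := by
  obtain ⟨Ck, hCk⟩ := FunctionSpaces.Torus.exists_forall_norm_le_of_continuous hk.gradient.continuous
  have hgc : Continuous fun y => FunctionSpaces.Torus.gradient k (x - y) :=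
    hk.gradient.continuous.comp (continuous_const.sub continuous_id)
  have hm : AEStronglyMeasurable (fun y => δ y * ⟪v x - v y, FunctionSpaces.Torus.gradient k (x - y)⟫_ℝ) volume :=
    hδ.aestronglyMeasurable.mul ((aestronglyMeasurable_const.sub hv).inner hgc.aestronglyMeasurable)
  refine Integrable.mono' ((hδ.norm.const_mul (‖v x‖ * Ck)).add (hvδ.norm.const_mul Ck)) hm
    (Eventually.of_forall fun y => ?_)
  simp only [Real.norm_eq_abs, abs_mul]
  have h1 : |⟪v x - v y, FunctionSpaces.Torus.gradient k (x - y)⟫_ℝ| ≤ (‖v x‖ + ‖v y‖) * Ck :=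
    (abs_real_inner_le_norm _ _).trans (mul_le_mul (norm_sub_le _ _) (hCk _) (norm_nonneg _)
      (by positivity))
  have hCk0 : 0 ≤ Ck := (norm_nonneg _).trans (hCk 0)
  calc |δ y| * |⟪v x - v y, FunctionSpaces.Torus.gradient k (x - y)⟫_ℝ|
      ≤ |δ y| * ((‖v x‖ + ‖v y‖) * Ck) := mul_le_mul_of_nonneg_left h1 (abs_nonneg _)
    _ = ‖v x‖ * Ck * |δ y| + Ck * (|‖v y‖| * |δ y|) := by rw [abs_norm]; ring

/-- **The `L¹` commutator bound through the translation modulus** (DiPerna–Lions 1989,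
Lemma II.1 (i) with `p = q = 2`): for `δ ∈ L²`, an a.e.-strongly measurable `v` with
`δ ‖v‖ ∈ L¹` and `‖v(· + z) - v‖_{L²} ≤ A` on the support of `∇k_ε`,
`∫ |r_ε[δ]| ≤ ‖δ‖_{L²} A C₁/ε`. [cite: DiPernaLions1989, Lemma II.1] -/
theorem lintegral_enorm_comm_le_of_translate (hδ : MemLp δ 2 volume) (hv : AEStronglyMeasurable v volume)
    (hε : 0 < ε) (hε' : ε ≤ 1 / 4)
    (hA : ∀ z : UnitAddTorus d, FunctionSpaces.Torus.gradient (FunctionSpaces.Torus.kernel ε) z ≠ 0 →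
      eLpNorm (fun y => v (y + z) - v y) 2 volume ≤ A) :
    ∫⁻ x, ‖∫ y, δ y * ⟪v x - v y,
        FunctionSpaces.Torus.gradient (FunctionSpaces.Torus.kernel ε) (x - y)⟫_ℝ‖ₑ ≤
      eLpNorm δ 2 volume * A * ENNReal.ofReal (ε⁻¹ * FunctionSpaces.Torus.gradProfileMass d) := by
  have h1 : ∀ x, ‖∫ y, δ y * ⟪v x - v y,
      FunctionSpaces.Torus.gradient (FunctionSpaces.Torus.kernel ε) (x - y)⟫_ℝ‖ₑ ≤
      ∫⁻ y, ‖δ y‖ₑ * ‖v x - v y‖ₑ * ‖FunctionSpaces.Torus.gradient (FunctionSpaces.Torus.kernel ε) (x - y)‖ₑ := by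
    intro x
    refine (enorm_integral_le_lintegral_enorm _).trans (lintegral_mono fun y => ?_)
    rw [enorm_mul, mul_assoc]
    refine mul_le_mul' le_rfl ?_
    rw [← ofReal_norm, ← ofReal_norm, ← ofReal_norm, ← ENNReal.ofReal_mul (norm_nonneg _)]
    exact ENNReal.ofReal_le_ofReal ((abs_real_inner_le_norm _ _).trans le_rfl)
  refine (lintegral_mono h1).trans ?_
  have h2 := lintegral_lintegral_weight_mul_sub_mul_gradient_kernel_le (a := fun y => ‖δ y‖ₑ)
    hδ.aestronglyMeasurable.enorm hv hε hε' hA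
  have e : (∫⁻ y, ‖δ y‖ₑ ^ (2 : ℝ)) ^ (1 / 2 : ℝ) = eLpNorm δ 2 volume := by
    rw [eLpNorm_eq_lintegral_rpow_enorm_toReal two_ne_zero ENNReal.ofNat_ne_top, ENNReal.toReal_ofNat]
  rwa [e] at h2

/-- `∫ ⟪v(x) - v(y), ∇k(x - y)⟫ dy = 0` for an integrable weakly divergence-free `v` and smooth `k`
(`∫ ∇k = 0` and `∫ ⟪v, ∇(k(x - ·))⟫ = 0`); integrable version of the tree's
`Torus.integral_inner_sub_gradient_eq_zero`. [folklore] -/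
theorem integral_inner_sub_gradient_eq_zero_of_integrable (hv : Integrable v volume)
    (hdiv : FunctionSpaces.Torus.IsWeaklyDivFree v) {k : UnitAddTorus d → ℝ}
    (hk : FunctionSpaces.Torus.IsSmooth k) (x : UnitAddTorus d) :
    ∫ y, ⟪v x - v y, FunctionSpaces.Torus.gradient k (x - y)⟫_ℝ = 0 := by
  have hgc : Continuous fun y => FunctionSpaces.Torus.gradient k (x - y) :=
    hk.gradient.continuous.comp (continuous_const.sub continuous_id)
  obtain ⟨Ck, hCk⟩ := FunctionSpaces.Torus.exists_forall_norm_le_of_continuous hk.gradient.continuous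
  have i1 : Integrable (fun y => ⟪v x, FunctionSpaces.Torus.gradient k (x - y)⟫_ℝ) volume :=
    (continuous_const.inner hgc).integrable_unitAddTorus
  have i2 : Integrable (fun y => ⟪v y, FunctionSpaces.Torus.gradient k (x - y)⟫_ℝ) volume := by
    refine Integrable.mono' (hv.norm.mul_const Ck) (hv.aestronglyMeasurable.inner hgc.aestronglyMeasurable)
      (Eventually.of_forall fun y => ?_)
    rw [Real.norm_eq_abs]
    exact (abs_real_inner_le_norm _ _).trans (mul_le_mul_of_nonneg_left (hCk _) (norm_nonneg _))
  simp_rw [inner_sub_left]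
  rw [integral_sub i1 i2, integral_inner hgc.integrable_unitAddTorus,
    integral_sub_left_eq_self (fun z => FunctionSpaces.Torus.gradient k z) volume x,
    FunctionSpaces.Torus.integral_gradient_eq_zero hk, inner_zero_right, zero_sub, neg_eq_zero]
  have h : (fun y => ⟪v y, FunctionSpaces.Torus.gradient k (x - y)⟫_ℝ) =
      fun y => -⟪v y, FunctionSpaces.Torus.gradient (fun z => k (x - z)) y⟫_ℝ := by
    funext y
    rw [FunctionSpaces.Torus.gradient_comp_sub_left k x y, inner_neg_right, neg_neg]
  rw [h, MeasureTheory.integral_neg, hdiv _ (hk.comp_sub_left x), neg_zero]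

/-- The commutator of a continuous slice, rewritten with differences:
`r_ε[g](x) = ∫ (g y - g x) ⟪v x - v y, ∇k_ε(x - y)⟫ dy` for integrable weakly divergence-free
`v`. [folklore] -/
theorem comm_eq_integral_sub_mul (hv : Integrable v volume) (hdiv : FunctionSpaces.Torus.IsWeaklyDivFree v)
    (hg : Continuous g) {k : UnitAddTorus d → ℝ} (hk : FunctionSpaces.Torus.IsSmooth k) (x : UnitAddTorus d) :
    ∫ y, g y * ⟪v x - v y, FunctionSpaces.Torus.gradient k (x - y)⟫_ℝ =
      ∫ y, (g y - g x) * ⟪v x - v y, FunctionSpaces.Torus.gradient k (x - y)⟫_ℝ := by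
  obtain ⟨Cg, hCg⟩ := FunctionSpaces.Torus.exists_forall_norm_le_of_continuous hg
  have hgi : Integrable g volume := hg.integrable_unitAddTorus
  have hvg : Integrable (fun y => ‖v y‖ * g y) volume :=
    hv.norm.mul_bdd hg.aestronglyMeasurable (Eventually.of_forall fun y => hCg y)
  have hI := integrable_commIntegrand_of_integrable hgi hv.aestronglyMeasurable hvg hk x
  have hI0 : Integrable (fun y => ⟪v x - v y, FunctionSpaces.Torus.gradient k (x - y)⟫_ℝ) volume := by
    have h1 := integrable_commIntegrand_of_integrable (δ := fun _ => (1 : ℝ)) (integrable_const 1)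
      hv.aestronglyMeasurable (by simpa using hv.norm) hk x
    simpa using h1
  have e : (fun y => (g y - g x) * ⟪v x - v y, FunctionSpaces.Torus.gradient k (x - y)⟫_ℝ) =
      fun y => g y * ⟪v x - v y, FunctionSpaces.Torus.gradient k (x - y)⟫_ℝ -
        g x * ⟪v x - v y, FunctionSpaces.Torus.gradient k (x - y)⟫_ℝ := by
    funext y; ring
  rw [e, integral_sub hI (hI0.const_mul _), MeasureTheory.integral_const_mul,
    integral_inner_sub_gradient_eq_zero_of_integrable hv hdiv hk x, mul_zero, sub_zero]

/-- **The `L¹` commutator of a continuous slice is small**: if `|g y - g x| ≤ w₀` whenever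
`‖x - y‖ ≤ ε`, then `∫ |r_ε[g]| ≤ w₀ A C₁/ε` (DiPerna–Lions 1989, proof of Lemma II.1 (ii)).
[cite: DiPernaLions1989, Lemma II.1] -/
theorem lintegral_enorm_comm_le_of_osc (hv : Integrable v volume) (hdiv : FunctionSpaces.Torus.IsWeaklyDivFree v)
    (hg : Continuous g) {w₀ : ℝ} (hε : 0 < ε) (hε' : ε ≤ 1 / 4)
    (hosc : ∀ x y : UnitAddTorus d, ‖x - y‖ ≤ ε → |g y - g x| ≤ w₀)
    (hA : ∀ z : UnitAddTorus d, FunctionSpaces.Torus.gradient (FunctionSpaces.Torus.kernel ε) z ≠ 0 →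
      eLpNorm (fun y => v (y + z) - v y) 2 volume ≤ A) :
    ∫⁻ x, ‖∫ y, g y * ⟪v x - v y,
        FunctionSpaces.Torus.gradient (FunctionSpaces.Torus.kernel ε) (x - y)⟫_ℝ‖ₑ ≤
      ENNReal.ofReal w₀ * A * ENNReal.ofReal (ε⁻¹ * FunctionSpaces.Torus.gradProfileMass d) := by
  set K : UnitAddTorus d → EuclideanSpace ℝ d :=
    FunctionSpaces.Torus.gradient (FunctionSpaces.Torus.kernel ε) with hK
  have hk := FunctionSpaces.Torus.isSmooth_kernel (d := d) hε hε'
  have h1 : ∀ x, ‖∫ y, g y * ⟪v x - v y, K (x - y)⟫_ℝ‖ₑ ≤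
      ∫⁻ y, ENNReal.ofReal w₀ * ‖v x - v y‖ₑ * ‖K (x - y)‖ₑ := by
    intro x
    rw [hK, comm_eq_integral_sub_mul hv hdiv hg hk x]
    refine (enorm_integral_le_lintegral_enorm _).trans (lintegral_mono fun y => ?_)
    by_cases hz : K (x - y) = 0
    · have : FunctionSpaces.Torus.gradient (FunctionSpaces.Torus.kernel ε) (x - y) = 0 := hz
      simp [this]
    · have hxy : ‖x - y‖ ≤ ε := FunctionSpaces.Torus.norm_le_of_gradient_kernel_ne_zero hε hε' hz
      rw [enorm_mul, mul_assoc]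
      refine mul_le_mul' ?_ ?_
      · rw [Real.enorm_eq_ofReal_abs]
        exact ENNReal.ofReal_le_ofReal (hosc x y hxy)
      · rw [← ofReal_norm, ← ofReal_norm, ← ofReal_norm, ← ENNReal.ofReal_mul (norm_nonneg _)]
        exact ENNReal.ofReal_le_ofReal (abs_real_inner_le_norm _ _)
  refine (lintegral_mono h1).trans ?_
  have h2 := lintegral_lintegral_weight_mul_sub_mul_gradient_kernel_le (a := fun _ => ENNReal.ofReal w₀)
    aemeasurable_const hv.aestronglyMeasurable hε hε' hA
  have e : (∫⁻ _ : UnitAddTorus d, ENNReal.ofReal w₀ ^ (2 : ℝ)) ^ (1 / 2 : ℝ) = ENNReal.ofReal w₀ := by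
    rw [lintegral_const, measure_univ, mul_one, ← ENNReal.rpow_mul]
    norm_num
  rwa [e] at h2

/-- Linearity of the commutator in the slice, integrable form:
`r[δ](x) = r[δ - g](x) + r[g](x)`. [folklore] -/
theorem comm_eq_comm_sub_add_comm_of_integrable (hδ : Integrable δ volume) (hg : Integrable g volume)
    (hv : AEStronglyMeasurable v volume) (hvδ : Integrable (fun y => ‖v y‖ * δ y) volume)
    (hvg : Integrable (fun y => ‖v y‖ * g y) volume)
    {k : UnitAddTorus d → ℝ} (hk : FunctionSpaces.Torus.IsSmooth k) (x : UnitAddTorus d) :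
    ∫ y, δ y * ⟪v x - v y, FunctionSpaces.Torus.gradient k (x - y)⟫_ℝ =
      (∫ y, (δ - g) y * ⟪v x - v y, FunctionSpaces.Torus.gradient k (x - y)⟫_ℝ) +
        ∫ y, g y * ⟪v x - v y, FunctionSpaces.Torus.gradient k (x - y)⟫_ℝ := by
  have hvδg : Integrable (fun y => ‖v y‖ * (δ - g) y) volume := by
    simp only [Pi.sub_apply, mul_sub]
    exact hvδ.sub hvg
  rw [← integral_add (integrable_commIntegrand_of_integrable (hδ.sub hg) hv hvδg hk x)
    (integrable_commIntegrand_of_integrable hg hv hvg hk x)]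
  refine integral_congr_ae (Eventually.of_forall fun y => ?_)
  simp only [Pi.sub_apply]
  ring

/-- **The quantitative `L¹` commutator bound** (DiPerna–Lions 1989, Lemma II.1): for `δ ∈ L²`
with `δ‖v‖ ∈ L¹`, an integrable weakly divergence-free `v` with translation modulus `A` at
scale `ε`, and any continuous `g` with oscillation `≤ w₀` at scale `ε`:
`∫ |r_ε[δ]| ≤ (‖δ - g‖_{L²} + w₀) A C₁/ε`. [cite: DiPernaLions1989, Lemma II.1] -/
theorem lintegral_enorm_comm_le_add (hδ : MemLp δ 2 volume) (hv : Integrable v volume)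
    (hvδ : Integrable (fun y => ‖v y‖ * δ y) volume) (hdiv : FunctionSpaces.Torus.IsWeaklyDivFree v)
    (hg : Continuous g) {w₀ : ℝ} (hε : 0 < ε) (hε' : ε ≤ 1 / 4)
    (hosc : ∀ x y : UnitAddTorus d, ‖x - y‖ ≤ ε → |g y - g x| ≤ w₀)
    (hA : ∀ z : UnitAddTorus d, FunctionSpaces.Torus.gradient (FunctionSpaces.Torus.kernel ε) z ≠ 0 →
      eLpNorm (fun y => v (y + z) - v y) 2 volume ≤ A) :
    ∫⁻ x, ‖∫ y, δ y * ⟪v x - v y,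
        FunctionSpaces.Torus.gradient (FunctionSpaces.Torus.kernel ε) (x - y)⟫_ℝ‖ₑ ≤
      (eLpNorm (δ - g) 2 volume + ENNReal.ofReal w₀) * A *
        ENNReal.ofReal (ε⁻¹ * FunctionSpaces.Torus.gradProfileMass d) := by
  have hk := FunctionSpaces.Torus.isSmooth_kernel (d := d) hε hε'
  obtain ⟨Cg, hCg⟩ := FunctionSpaces.Torus.exists_forall_norm_le_of_continuous hg
  have hgi : Integrable g volume := hg.integrable_unitAddTorus
  have hδi : Integrable δ volume := hδ.integrable one_le_two
  have hvg : Integrable (fun y => ‖v y‖ * g y) volume :=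
    hv.norm.mul_bdd hg.aestronglyMeasurable (Eventually.of_forall fun y => hCg y)
  have hsplit := fun x => comm_eq_comm_sub_add_comm_of_integrable hδi hgi hv.aestronglyMeasurable hvδ hvg hk x
  simp_rw [hsplit]
  have hmg : MemLp g 2 volume :=
    (memLp_top_of_bound hg.aestronglyMeasurable Cg (Eventually.of_forall hCg)).mono_exponent le_top
  -- measurability of the first commutator in `x`
  have hmeas : AEStronglyMeasurable (fun x => ∫ y, (δ - g) y * ⟪v x - v y,
      FunctionSpaces.Torus.gradient (FunctionSpaces.Torus.kernel ε) (x - y)⟫_ℝ) volume := by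
    have hKc : Continuous fun p : UnitAddTorus d × UnitAddTorus d =>
        FunctionSpaces.Torus.gradient (FunctionSpaces.Torus.kernel ε) (p.1 - p.2) :=
      (FunctionSpaces.Torus.continuous_gradient_kernel (d := d) hε hε').comp (continuous_fst.sub continuous_snd)
    have hP : AEStronglyMeasurable (Function.uncurry fun (x y : UnitAddTorus d) => (δ - g) y * ⟪v x - v y,
        FunctionSpaces.Torus.gradient (FunctionSpaces.Torus.kernel ε) (x - y)⟫_ℝ)
        ((volume : Measure (UnitAddTorus d)).prod volume) :=
      ((hδi.sub hgi).aestronglyMeasurable.comp_snd).mul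
        (((hv.aestronglyMeasurable.comp_fst).sub (hv.aestronglyMeasurable.comp_snd)).inner
          hKc.aestronglyMeasurable)
    exact hP.integral_prod_right'
  calc ∫⁻ x, ‖(∫ y, (δ - g) y * ⟪v x - v y, FunctionSpaces.Torus.gradient (FunctionSpaces.Torus.kernel ε) (x - y)⟫_ℝ) +
          ∫ y, g y * ⟪v x - v y, FunctionSpaces.Torus.gradient (FunctionSpaces.Torus.kernel ε) (x - y)⟫_ℝ‖ₑ
      ≤ ∫⁻ x, ‖∫ y, (δ - g) y * ⟪v x - v y, FunctionSpaces.Torus.gradient (FunctionSpaces.Torus.kernel ε) (x - y)⟫_ℝ‖ₑ +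
          ‖∫ y, g y * ⟪v x - v y, FunctionSpaces.Torus.gradient (FunctionSpaces.Torus.kernel ε) (x - y)⟫_ℝ‖ₑ :=
        lintegral_mono fun x => enorm_add_le _ _
    _ = (∫⁻ x, ‖∫ y, (δ - g) y * ⟪v x - v y, FunctionSpaces.Torus.gradient (FunctionSpaces.Torus.kernel ε) (x - y)⟫_ℝ‖ₑ) +
          ∫⁻ x, ‖∫ y, g y * ⟪v x - v y, FunctionSpaces.Torus.gradient (FunctionSpaces.Torus.kernel ε) (x - y)⟫_ℝ‖ₑ :=
        lintegral_add_left' hmeas.enorm _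
    _ ≤ eLpNorm (δ - g) 2 volume * A * ENNReal.ofReal (ε⁻¹ * FunctionSpaces.Torus.gradProfileMass d) +
          ENNReal.ofReal w₀ * A * ENNReal.ofReal (ε⁻¹ * FunctionSpaces.Torus.gradProfileMass d) :=
        add_le_add (lintegral_enorm_comm_le_of_translate (hδ.sub hmg) hv.aestronglyMeasurable hε hε' hA)
          (lintegral_enorm_comm_le_of_osc hv hdiv hg hε hε' hosc hA)
    _ = _ := by ring

/-- **Strong convergence of the commutators in `L¹`** (DiPerna–Lions 1989, Lemma II.1 (ii)) for
drifts with an `O(ε)` translation modulus in `L²` (e.g. `v ∈ Ḣ¹`): if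
`‖v(· + z) - v‖_{L²} ≤ εₙ B` on the support of `∇k_{εₙ}`, `εₙ → 0`, then `∫ |r_{εₙ}[δ]| → 0`
(density of continuous functions in `L²` and the quantitative bound
`lintegral_enorm_comm_le_add`). [cite: DiPernaLions1989, Lemma II.1] -/
theorem tendsto_lintegral_enorm_comm (hδ : MemLp δ 2 volume) (hv : Integrable v volume)
    (hvδ : Integrable (fun y => ‖v y‖ * δ y) volume) (hdiv : FunctionSpaces.Torus.IsWeaklyDivFree v)
    {B : ℝ≥0∞} (hB : B ≠ ⊤) {εs : ℕ → ℝ} (hεs : ∀ n, 0 < εs n) (hεs' : ∀ n, εs n ≤ 1 / 4)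
    (hεs0 : Tendsto εs atTop (𝓝 0))
    (hA : ∀ n (z : UnitAddTorus d), FunctionSpaces.Torus.gradient (FunctionSpaces.Torus.kernel (εs n)) z ≠ 0 →
      eLpNorm (fun y => v (y + z) - v y) 2 volume ≤ ENNReal.ofReal (εs n) * B) :
    Tendsto (fun n => ∫⁻ x, ‖∫ y, δ y * ⟪v x - v y,
        FunctionSpaces.Torus.gradient (FunctionSpaces.Torus.kernel (εs n)) (x - y)⟫_ℝ‖ₑ) atTop (𝓝 0) := by
  set C₁ : ℝ := FunctionSpaces.Torus.gradProfileMass d with hC₁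
  have hC₁0 : 0 ≤ C₁ := FunctionSpaces.Torus.gradProfileMass_nonneg
  rw [ENNReal.tendsto_atTop_zero]
  intro η hη
  -- reduce to a finite target
  set η' : ℝ≥0∞ := min η 1 with hη'
  have hη'0 : η' ≠ 0 := (lt_min hη zero_lt_one).ne'
  have hη't : η' ≠ ⊤ := ((min_le_right _ _).trans_lt ENNReal.one_lt_top).ne
  -- the constant `M = B C₁ + 1`
  set M : ℝ≥0∞ := B * ENNReal.ofReal C₁ + 1 with hM
  have hMt : M ≠ ⊤ := ENNReal.add_ne_top.2 ⟨ENNReal.mul_ne_top hB ENNReal.ofReal_ne_top, ENNReal.one_ne_top⟩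
  have hM0 : M ≠ 0 := by simp [hM]
  set η₁ : ℝ≥0∞ := η' / 2 / M with hη₁
  have hη₁0 : η₁ ≠ 0 := (ENNReal.div_pos (ENNReal.half_pos hη'0).ne' hMt).ne'
  have hη₁t : η₁ ≠ ⊤ := ENNReal.div_ne_top (ENNReal.div_ne_top hη't two_ne_zero) hM0
  -- a continuous `g` with `‖δ - g‖_{L²} ≤ η₁`
  obtain ⟨gb, hgδ, -⟩ := hδ.exists_boundedContinuous_eLpNorm_sub_le ENNReal.ofNat_ne_top hη₁0
  set g : UnitAddTorus d → ℝ := ⇑gb with hg_def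
  have hg : Continuous g := gb.continuous
  -- uniform continuity of `g` at level `η₁.toReal`
  have hη₁r : 0 < η₁.toReal := ENNReal.toReal_pos hη₁0 hη₁t
  obtain ⟨ρ, hρ, hU⟩ := Metric.uniformContinuous_iff.1 (CompactSpace.uniformContinuous_of_continuous hg)
    η₁.toReal hη₁r
  obtain ⟨N, hN⟩ := eventually_atTop.1 (hεs0.eventually (gt_mem_nhds hρ))
  refine ⟨N, fun n hn => ?_⟩
  have hεn : εs n < ρ := hN n hn
  have hosc : ∀ x y : UnitAddTorus d, ‖x - y‖ ≤ εs n → |g y - g x| ≤ η₁.toReal := by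
    intro x y hxy
    have : dist y x < ρ := by rw [dist_eq_norm, ← norm_neg, neg_sub]; linarith
    have := hU this
    rw [Real.dist_eq] at this
    exact this.le
  have hb := lintegral_enorm_comm_le_add (A := ENNReal.ofReal (εs n) * B) hδ hv hvδ hdiv hg
    (hεs n) (hεs' n) hosc (hA n)
  refine hb.trans ?_
  have hsub : eLpNorm (δ - g) 2 volume ≤ η₁ := hgδ
  calc (eLpNorm (δ - g) 2 volume + ENNReal.ofReal η₁.toReal) * (ENNReal.ofReal (εs n) * B) *
        ENNReal.ofReal ((εs n)⁻¹ * C₁)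
      ≤ (η₁ + η₁) * (ENNReal.ofReal (εs n) * B) * ENNReal.ofReal ((εs n)⁻¹ * C₁) := by
        gcongr
        rw [ENNReal.ofReal_toReal hη₁t]
    _ = (η₁ + η₁) * (B * ENNReal.ofReal C₁) := by
        rw [ENNReal.ofReal_mul (inv_nonneg.2 (hεs n).le), ENNReal.ofReal_inv_of_pos (hεs n)]
        have hε0 : ENNReal.ofReal (εs n) ≠ 0 := (ENNReal.ofReal_pos.2 (hεs n)).ne'
        have hεt : ENNReal.ofReal (εs n) ≠ ⊤ := ENNReal.ofReal_ne_top
        calc (η₁ + η₁) * (ENNReal.ofReal (εs n) * B) * ((ENNReal.ofReal (εs n))⁻¹ * ENNReal.ofReal C₁)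
            = (η₁ + η₁) * B * ENNReal.ofReal C₁ * (ENNReal.ofReal (εs n) * (ENNReal.ofReal (εs n))⁻¹) := by ring
          _ = (η₁ + η₁) * (B * ENNReal.ofReal C₁) := by rw [ENNReal.mul_inv_cancel hε0 hεt]; ring
    _ ≤ (η₁ + η₁) * M := by gcongr; exact le_self_add
    _ = η' := by
        rw [← two_mul, hη₁, mul_assoc, ENNReal.div_mul_cancel hM0 hMt,
          ENNReal.mul_div_cancel two_ne_zero ENNReal.ofNat_ne_top]
    _ ≤ η := min_le_left _ _

end Commutator

end Torus

end Literature.Analysis.FluidPDE
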